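import Literature.NumberTheory.GaloisRepresentations.LocalWeilDatumRelative
import Literature.NumberTheory.GaloisRepresentations.LocalGaloisSolvable
import Literature.NumberTheory.GaloisRepresentations.LocalFieldFiniteExtension
import HarnessLib

/-!
# The Galois pairs of the local Weil datum are solvable

Topic `NumberTheory/GaloisRepresentations`; namespace
`Literature.NumberTheory.GaloisRepresentations.LocalWeilDatum`.  THEOREMS ONLY.  For a
non-archimedean local field `F` and finite `E ≤ L ⊆ F^sep ⊆ F̄` with `W_F ∩ G_E` normalising
`W_F ∩ G_L` (`L/E` Galois), the quotient `(W_F ∩ G_E)/(W_F ∩ G_L)` — which injects into `Gal(L/E)`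
(`relRestrict`, `relRestrict_eq_one_iff`) — is SOLVABLE, by Serre's Cor. 5 of *Local Fields* IV §2
("the Galois group of a finite Galois extension of a non-archimedean local field is solvable", tree
`isSolvable_algEquiv_of_isGalois`, here over the local field `E`).  This is the hypothesis of
`AbstractCFT.WeilDatum.IsClassFieldTheory.exists_recMap_eq_of_isSolvable` (surjectivity of
Neukirch's `r_{L|E}` beyond the abelian case) for the local datum; used by the local transfer
theorem (Neukirch IV (5.9) at the level of `θ_E`).
-/

noncomputable section

open Field IsNonarchimedeanLocalField ValuativeRel
open scoped Pointwise

namespace Literature.NumberTheory.GaloisRepresentations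

namespace LocalWeilDatum

open AbstractCFT

variable (F : Type*) [Field F] [ValuativeRel F] [TopologicalSpace F] [IsNonarchimedeanLocalField F]
  {E L : IntermediateField F (AlgebraicClosure F)}

/-- **`(W_F ∩ G_E)/(W_F ∩ G_L)` is solvable** for finite `E ≤ L ⊆ F^sep` with `W_F ∩ G_E`
normalising `W_F ∩ G_L`: it injects into `Gal(L/E)` (`relRestrict`), which is solvable since `E` is
itself a non-archimedean local field and `L/E` is Galois (Serre IV §2 Cor. 5,
`isSolvable_algEquiv_of_isGalois`). [cite: SerreLocalFields1979, Ch. IV §2 Cor. 5 of Prop. 7] -/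
theorem isSolvable_fieldSubgroup_quotient [FiniteDimensional F E] [FiniteDimensional F L]
    (hEL : E ≤ L) (hLs : L ≤ sepClosure F)
    (hUn : fieldSubgroup F E ≤
      Subgroup.normalizer ((fieldSubgroup F L : Subgroup (WeilGroup F)) : Set (WeilGroup F))) :
    haveI : ((fieldSubgroup F L).subgroupOf (fieldSubgroup F E)).Normal :=
      (Subgroup.normal_subgroupOf_iff_le_normalizer (fieldSubgroup_antitone F hEL)).mpr hUn
    IsSolvable (fieldSubgroup F E ⧸ (fieldSubgroup F L).subgroupOf (fieldSubgroup F E)) := by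
  haveI hN : ((fieldSubgroup F L).subgroupOf (fieldSubgroup F E)).Normal :=
    (Subgroup.normal_subgroupOf_iff_le_normalizer (fieldSubgroup_antitone F hEL)).mpr hUn
  letI := towerAlgebra hEL
  haveI := towerAlgebra_isScalarTower_bot hEL
  haveI := towerAlgebra_finiteDimensional (F := F) hEL
  haveI : IsGalois E L := (isGalois_of_le_normalizer F hEL hLs hUn).1
  -- `E` is a non-archimedean local field, so `Gal(L/E)` is solvable
  letI := FiniteExtension.valuativeRel F E
  letI := FiniteExtension.topologicalSpace F E
  haveI := FiniteExtension.isNonarchimedeanLocalField F E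
  haveI hsol : IsSolvable (L ≃ₐ[E] L) := isSolvable_algEquiv_of_isGalois (F := E) L
  -- the injection `U/V ↪ Gal(L/E)`
  let f : fieldSubgroup F E ⧸ (fieldSubgroup F L).subgroupOf (fieldSubgroup F E) →* (L ≃ₐ[E] L) :=
    QuotientGroup.lift _ (relRestrict F hEL hLs hUn) fun w hw => by
      rw [Subgroup.mem_subgroupOf] at hw
      exact (relRestrict_eq_one_iff F hEL hLs hUn w).mpr hw
  refine solvable_of_solvable_injective (f := f) ?_
  rw [injective_iff_map_eq_one]
  intro x hx
  induction x using QuotientGroup.induction_on with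
  | H w =>
    rw [QuotientGroup.lift_mk] at hx
    rw [QuotientGroup.eq_one_iff, Subgroup.mem_subgroupOf]
    exact (relRestrict_eq_one_iff F hEL hLs hUn w).mp hx

end LocalWeilDatum

end Literature.NumberTheory.GaloisRepresentations
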